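import Literature.Probability.Percolation.SepArmsOnGlue
import HarnessLib

/-!
# Non-vacuity of the well-separated events `sepArmsOn κ s` (prescribed landing sides)

Topic: Probability / Percolation; family `crit-perc` (critical site percolation `P = P_{1/2}` on the
triangular lattice `𝕋`). Sanity companion of `SepArmsOnGlue.lean` / `SepArmsOnQuasiMult.lean`
(toward `Literature.Probability.Percolation.Nolin2008_prop17_quasiMult`; P. Nolin, *Near-critical
percolation in two dimensions*, EJP 13 (2008), Prop. 17 [arXiv 0711.4948: Prop. 16]): for an injective
landing assignment `s : Fin k → Fin 6` and `16 ≤ n ≤ N`, `P_{1/2}(sepArmsOn κ s n N) > 0` — the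
necessary condition of the separation hypothesis `c · π_κ(n, N) ≤ P_{1/2}(sepArmsOn κ s n N)`
(Nolin's Thm. 11 [arXiv Thm. 10] for the pattern `(k, κ)` and the landing sides `s`). Verbatim the
argument of `SepArmsNonvacuity.lean` (the case `s j = j`):

* `coneConfigOn κ s` — the configuration open exactly on the cones `ρ^{s j}(triCone)`, `κ j = true`;
* `triCone_le_readFrame_coneConfigOn`, `coneConfigOn_mem_sepArmsOn`, `determinedBy_sepArmsOn`,
  `triSitePercolation_sepArmsOn_pos`.

Everything here is PROVED; no named fact is introduced.

## References

* P. Nolin, *Near-critical percolation in two dimensions*, Electron. J. Probab. 13 (2008), §4.2–4.3,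
  Thm. 11 [arXiv 0711.4948: Def. 6–8, Thm. 10]. [Nolin2008]

Tree: `sepArmsOn`, `sepArmsOn_eq_inter`, `determinedBy_sepArmsOnCol` (`SepArmsOnGlue.lean`); `triCone`,
`readFrame`, `mem_readFrame`, `mem_sepArmAt`, `isUpperSet_sepOpenArmIn` (`ArmSeparationFourArm.lean`);
`cone_mem_sepOpenArmIn`, `image_rot_sepConeSupport_subset_ball` (`ArmSeparationFourArmProofs.lean`);
`rot_sector_injective` (`ArmEventsAPrioriPoly.lean`); `TwoArmPos.triSitePercolation_half_cylinder_pos`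
(`ArmEventsProofs.lean`).
-/

noncomputable section

open MeasureTheory Set

namespace Literature.Probability.Percolation

open LatticeModels

variable {k : ℕ}

/-! ### Non-vacuity of `sepArmsOn κ s`: the configuration open exactly on the cones of the open sides -/

/-- **The cone configuration of colours `κ`**: open exactly on the open cones `ρ^j(triCone)` over the
sides `j` with `κ j = true` (`k ≤ 6`). [folklore] -/
def coneConfigOn (κ : Fin k → Bool) (s : Fin k → Fin 6) : SiteConfig (Site 2) :=
  {v | ∃ j : Fin k, κ j = true ∧ (triRotIsoPow (s j).val).symm v ∈ triCone}

/-- Read in the frame and colour of ANY arm, the cone configuration contains the open cone over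
side `0`: for an open side `j` the cone `ρ^j(triCone)` is open; for a closed side `j` it is closed,
the open cones being those of other sides (`rot_sector_injective`). [folklore] -/
theorem triCone_le_readFrame_coneConfigOn (κ : Fin k → Bool) (s : Fin k → Fin 6) (hs : Function.Injective s) (j : Fin k) :
    (triCone : Set (Site 2)) ≤ readFrame (s j).val (κ j) (coneConfigOn κ s) := by
  intro v hv
  rw [mem_readFrame]
  cases hj : κ j
  · simp only [Bool.false_eq_true, iff_false, coneConfigOn, mem_setOf_eq, not_exists, not_and]
    intro i hi hci
    have e : triRotIsoPow (s i).val ((triRotIsoPow (s i).val).symm (triRotIsoPow (s j).val v)) = triRotIsoPow (s j).val v :=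
      RelIso.apply_symm_apply _ _
    have hij : (s i).val = (s j).val := rot_sector_injective (s i).2 (s j).2 hci hv e
    have : κ i = κ j := by rw [hs (Fin.ext hij)]
    rw [hi, hj] at this
    exact Bool.noConfusion this
  · simp only [iff_true, coneConfigOn, mem_setOf_eq]
    exact ⟨j, hj, by rw [RelIso.symm_apply_apply]; exact hv⟩

/-- **The cone configuration lies in `sepArmsOn κ s n N`** for `k ≤ 6`, `16 ≤ n ≤ N`: each arm `j` is
carried by the cone `ρ^j(triCone)` (carriers pairwise disjoint), in whose frame and colour the
configuration contains the open cone, which realises the fenced open arm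
(`cone_mem_sepOpenArmIn`, monotonicity of `sepOpenArmIn`). [cite: Nolin2008, Thm. 11 (arXiv 0711.4948: Thm. 10)] -/
theorem coneConfigOn_mem_sepArmsOn (κ : Fin k → Bool) (s : Fin k → Fin 6) (hs : Function.Injective s) {n N : ℕ} (hn : 16 ≤ n) (hnN : n ≤ N) :
    coneConfigOn κ s ∈ sepArmsOn κ s n N := by
  have K := cone_mem_sepOpenArmIn hn hnN
  refine ⟨fun j => {w | (triRotIsoPow (s j).val).symm w ∈ triCone}, fun i j hij _ => ?_, fun j => ?_⟩
  · rw [Set.disjoint_left]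
    intro w hi hj'
    rw [mem_setOf_eq] at hi hj'
    have e : triRotIsoPow (s i).val ((triRotIsoPow (s i).val).symm w) = triRotIsoPow (s j).val ((triRotIsoPow (s j).val).symm w) := by
      rw [RelIso.apply_symm_apply, RelIso.apply_symm_apply]
    exact hij (hs (Fin.ext (rot_sector_injective (s i).2 (s j).2 hi hj' e)))
  · rw [mem_sepArmAt]
    have e : (triRotIsoPow (s j).val) ⁻¹' {w : Site 2 | (triRotIsoPow (s j).val).symm w ∈ triCone} = triCone := by
      ext v; rw [mem_preimage, mem_setOf_eq, RelIso.symm_apply_apply]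
    rw [e]
    exact isUpperSet_sepOpenArmIn _ n N (triCone_le_readFrame_coneConfigOn κ s hs j) K

/-- `sepArmsOn κ s n N` is determined by the sites of `Λ_{N + N/8}` (`4 ≤ n ≤ N`). [folklore] -/
theorem determinedBy_sepArmsOn (κ : Fin k → Bool) (s : Fin k → Fin 6) {n N : ℕ} (h4 : 4 ≤ n) (hnN : n ≤ N) :
    DeterminedBy (sepArmsOn κ s n N) ↑(triBall (N + N / 8)) := by
  rw [sepArmsOn_eq_inter]
  exact (determinedBy_sepArmsOnCol κ s true h4 hnN fun j _ => image_rot_sepConeSupport_subset_ball (s j).val n N).inter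
    (determinedBy_sepArmsOnCol κ s false h4 hnN fun j _ => image_rot_sepConeSupport_subset_ball (s j).val n N)

/-- **The well-separated `k`-arm event has positive probability** (`k ≤ 6`, `16 ≤ n ≤ N`): it is
determined by the sites of `Λ_{N + N/8}` and contains the cone configuration, hence the cylinder
event of the configurations agreeing with it there. This is the necessary condition
`P_{1/2}(sepArmsOn κ s n N) > 0` for the separation hypothesis
`c · π_κ(n, N) ≤ P_{1/2}(sepArmsOn κ s n N)` of `polyArmProb_quasiMult_of_sepArmsOn_separation` whenever
`π_κ(n, N) > 0` — a consistency check of the Lean rendering, not a proof of it. [cite: Nolin2008, Thm. 11 (arXiv 0711.4948: Thm. 10)] -/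
theorem triSitePercolation_sepArmsOn_pos (κ : Fin k → Bool) (s : Fin k → Fin 6) (hs : Function.Injective s) {n N : ℕ} (hn : 16 ≤ n) (hnN : n ≤ N) :
    0 < (triSitePercolation half).real (sepArmsOn κ s n N) := by
  classical
  have h4 : 4 ≤ n := le_trans (by norm_num) hn
  have dS := determinedBy_sepArmsOn κ s h4 hnN
  have hcyl : {ω : Set (Site 2) | ∀ v ∈ triBall (N + N / 8), (v ∈ ω ↔ v ∈ coneConfigOn κ s)} ⊆ sepArmsOn κ s n N := by
    intro ω hω
    have heq : ω ∩ ↑(triBall (N + N / 8)) = coneConfigOn κ s ∩ ↑(triBall (N + N / 8)) := by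
      ext v
      simp only [mem_inter_iff, Finset.mem_coe]
      constructor
      · rintro ⟨h1, h2⟩; exact ⟨(hω v h2).1 h1, h2⟩
      · rintro ⟨h1, h2⟩; exact ⟨(hω v h2).2 h1, h2⟩
    exact ((determinedBy_iff _ _).1 dS ω (coneConfigOn κ s) heq).2 (coneConfigOn_mem_sepArmsOn κ s hs hn hnN)
  exact (TwoArmPos.triSitePercolation_half_cylinder_pos (triBall (N + N / 8))
    (fun v => v ∈ coneConfigOn κ s)).trans_le (measureReal_mono hcyl (measure_ne_top _ _))

end Literature.Probability.Percolation

end
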